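import Summits.CriticalPhenomena.Ising3DConformalLimit.Theses.SynchronousCoupling
import Literature.Probability.LatticeModels.ProductMeasureTools

/-!
# `RotationJoining` (crux stmt-CriticalPhenomena-18763, route `SynchronousCoupling`), negative-side
# support, module 0: the named pieces of the crux and the objects of its load-bearing analysis

`RotationJoining` claims: for every `μ ∈ 𝒢(β_c)` (n.n. Ising on `ℤ³`, `h = 0`) that is translation
invariant, `∃ C θ > 0 ∀ n ≥ 1 ∀ m ∃ π ∈ Couplings(μ, μ) ∀ |u_i| ≤ m`, the `L²(π)`-distance between
the self-normalised spin sum of copy 1 over the rotated cell `T⁻¹(n(u+[0,1)³))` (`T = A/3`,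
`A = ((2,2,−1),(−1,2,2),(2,−1,2))`, `AAᵀ = 9I`) and the self-normalised spin sum of copy 2 over the
axis cell `n(u+[0,1)³)` is `≤ C n^(−θ)`.

This module only NAMES things (definitions are review-queued, D-0009, so they are collected here;
every lemma about them lives in the sibling proof-only modules `Geometry`, `ShiftInequality`,
`LayeredMeasure`, `RotationJoiningFalseWithoutGibbs`):

* the pieces of the crux — `A`, `box`, `rotCell`, `rotCell₀`, `axisCell`, `axisCell₀`,
  `blockSum`, `normaliser`, `defect` — with the READ-BACK `rotationJoining_iff` (`Iff.rfl`):
  the crux is literally `∀ μ ∈ 𝒢(β_c), TI μ → ∃ C θ > 0 ∀ n ≥ 1 ∀ m ∃ π, π.fst = μ ∧ π.snd = μ ∧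
  ∀ |u_i| ≤ m, defect μ n m u π ≤ C n^(−θ)`;
* the translation vector `tvec k = k·Aᵀe₀ = (2k, 2k, −k)` carrying the reference rotated cell to
  the rotated cell of index `e₀` when `n = 3k` (Σ3 commensurability);
* the COUNTER-MEASURE of the load-bearing analysis: `coin` (fair `±1`), `P = ⨂_{ℤ} coin`,
  `layer ε x := ε (x 2)`, `μL := P.map layer` (horizontally layered i.i.d. fair spins — a
  translation-invariant probability measure that is not a Gibbs measure of the model);
* its bookkeeping: layer `profile`s, the layer window `Kwin`, the second moments `V0`, `V1`, and
  the four normalised block readings `Fk`, `Gk` (copy 1, rotated cells `0`, `e₀`) and `Hk`, `Kk`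
  (copy 2, axis cells `0`, `e₀`) on the coupled space at scale `n = 3k`.

Refuter cdisprove seat (cycle 1); nothing here refutes the crux.
-/

namespace Summit.CriticalPhenomena.Ising3DConformalLimit.Theorems.RotationJoining.Negative

open MeasureTheory Finset
open Literature.Probability.LatticeModels
open Summit.CriticalPhenomena.Ising3DConformalLimit.Theses.SynchronousCoupling

noncomputable section

/-! ## The crux, re-read through named pieces -/

/-- The integer matrix `A = 3T` of the crux (`A Aᵀ = 9·I`, `det A = 27`). -/
def A : Matrix (Fin 3) (Fin 3) ℤ := !![(2:ℤ), 2, -1; -1, 2, 2; 2, -1, 2]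

/-- The bounding box `[-2n(m+1), 2n(m+1)]³` in which copy 1 is read. -/
def box (n m : ℕ) : Finset (Site 3) :=
  Fintype.piFinset (fun _ : Fin 3 => Finset.Icc (-(2 * ((n:ℤ)) * ((m:ℤ) + 1))) (2 * ((n:ℤ)) * ((m:ℤ) + 1)))

/-- The rotated cell of index `u` at scale `n`: lattice points `x` of the box with
`A x ∈ 3n(u + [0,1)³)`, i.e. `x ∈ T⁻¹(n(u+[0,1)³))`. -/
def rotCell (n m : ℕ) (u : Fin 3 → ℤ) : Finset (Site 3) :=
  (box n m).filter (fun x => ∀ i, 3 * ((n:ℤ)) * u i ≤ Matrix.mulVec A x i ∧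
    Matrix.mulVec A x i < 3 * ((n:ℤ)) * (u i + 1))

/-- The reference rotated cell (`u = 0`) exactly as the crux writes the normaliser of copy 1. -/
def rotCell₀ (n m : ℕ) : Finset (Site 3) :=
  (box n m).filter (fun x => ∀ i, 0 ≤ Matrix.mulVec A x i ∧ Matrix.mulVec A x i < 3 * ((n:ℤ)))

/-- The axis cell `n(u + [0,1)³) ∩ ℤ³` of copy 2. -/
def axisCell (n : ℕ) (u : Fin 3 → ℤ) : Finset (Site 3) :=
  Fintype.piFinset (fun i : Fin 3 => Finset.Ico ((n:ℤ) * u i) ((n:ℤ) * u i + (n:ℤ)))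

/-- The reference axis cell `[0,n)³` (normaliser of copy 2). -/
def axisCell₀ (n : ℕ) : Finset (Site 3) :=
  Fintype.piFinset (fun _ : Fin 3 => Finset.Ico (0:ℤ) ((n:ℤ)))

/-- Block spin sum `Σ_{x ∈ s} σ_x`. -/
def blockSum (s : Finset (Site 3)) (σ : SpinConfig (Site 3)) : ℝ := ∑ x ∈ s, spinAt x σ

/-- The self-normalisation `(E_μ[(Σ_{x∈s} σ_x)²])^{-1/2}` (junk `0` if the second moment vanishes). -/
def normaliser (μ : Measure (SpinConfig (Site 3))) (s : Finset (Site 3)) : ℝ :=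
  (Real.sqrt (∫ σ, (blockSum s σ) ^ 2 ∂μ))⁻¹

/-- The `L²(π)` defect of block `u` at scale `n`, window `m`, under the coupling `π`. -/
def defect (μ : Measure (SpinConfig (Site 3))) (n m : ℕ) (u : Fin 3 → ℤ)
    (π : Measure (SpinConfig (Site 3) × SpinConfig (Site 3))) : ℝ :=
  ∫ q, (normaliser μ (rotCell₀ n m) * blockSum (rotCell n m u) q.1 -
    normaliser μ (axisCell₀ n) * blockSum (axisCell n u) q.2) ^ 2 ∂π

/-- READ-BACK: the crux is literally `∀ μ ∈ 𝒢(β_c), μ translation invariant → ∃ C θ > 0, …` with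
the defect above (definitional unfolding only). -/
theorem rotationJoining_iff :
    RotationJoining ↔ ∀ μ ∈ isingGibbsMeasures 3 (criticalBeta 3) 0,
      IsTranslationInvariantMeasure μ → ∃ C θ : ℝ, 0 < θ ∧ ∀ n m : ℕ, 1 ≤ n →
      ∃ π : Measure (SpinConfig (Site 3) × SpinConfig (Site 3)), π.fst = μ ∧ π.snd = μ ∧
        ∀ u : Fin 3 → ℤ, (∀ i, |u i| ≤ m) → defect μ n m u π ≤ C * (n : ℝ) ^ (-θ) := Iff.rfl

/-- For `n = 3k` the rotated cells are lattice translates: `t = k·Aᵀe₀ = (2k, 2k, -k)`. -/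
def tvec (k : ℕ) : Site 3 := ![2 * (k:ℤ), 2 * (k:ℤ), -(k:ℤ)]

/-- Coordinate `0` of `tvec k`. -/
@[simp] theorem tvec_zero (k : ℕ) : tvec k 0 = 2 * (k:ℤ) := rfl

/-- Coordinate `1` of `tvec k`. -/
@[simp] theorem tvec_one (k : ℕ) : tvec k 1 = 2 * (k:ℤ) := rfl

/-- Coordinate `2` of `tvec k`. -/
@[simp] theorem tvec_two (k : ℕ) : tvec k 2 = -(k:ℤ) := rfl

/-! ## The counter-measure: horizontally layered i.i.d. fair spins -/

/-- Fair coin on `ℤˣ = {1, -1}`. -/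
def coin : Measure ℤˣ := (2:ENNReal)⁻¹ • Measure.dirac 1 + (2:ENNReal)⁻¹ • Measure.dirac (-1)

/-- The fair coin is a probability measure. -/
instance coin_isProbabilityMeasure : IsProbabilityMeasure coin :=
  ⟨by simp [coin, ENNReal.inv_two_add_inv_two]⟩

/-- i.i.d. fair spins indexed by the layers `ℤ`. -/
def P : Measure (ℤ → ℤˣ) := Measure.infinitePi (fun _ : ℤ => coin)

/-- `P` is a probability measure. -/
instance P_isProbabilityMeasure : IsProbabilityMeasure P := by
  unfold P; infer_instance

/-- The layering map `σ_x := ε_{x₂}`: configurations constant on the planes `x₂ = const`. -/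
def layer (ε : ℤ → ℤˣ) : SpinConfig (Site 3) := fun x => ε (x 2)

/-- The layering map is measurable. -/
@[fun_prop]
theorem measurable_layer : Measurable layer :=
  measurable_pi_lambda _ (fun x => measurable_pi_apply (x 2))

/-- The counter-measure: horizontally layered i.i.d. fair spins. -/
def μL : Measure (SpinConfig (Site 3)) := P.map layer

/-- `μL` is a probability measure. -/
instance μL_isProbabilityMeasure : IsProbabilityMeasure μL :=
  Measure.isProbabilityMeasure_map measurable_layer.aemeasurable

/-! ## Bookkeeping at scale `n = 3k` -/

/-- The layer profile of a finite set of sites: number of its points on the plane `x₂ = j`. -/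
def profile (s : Finset (Site 3)) (j : ℤ) : ℝ := ((s.filter (fun x => x 2 = j)).card : ℝ)

/-- A window of layers containing every layer met by the cells in play at `n = 3k`, `m = 1`. -/
def Kwin (k : ℕ) : Finset ℤ := Finset.Icc (-(20 * (k:ℤ))) (20 * (k:ℤ))

/-- `V₀(k) = Σ_j profile_j²` (= second moment of the reference rotated block sum under `μL`). -/
def V0 (k : ℕ) : ℝ := ∑ j ∈ Kwin k, profile (rotCell₀ (3 * k) 1) j ^ 2

/-- `V₁(k) = Σ_j (profile_j - profile_{j+k})²` (= second moment of the difference of the rotated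
block sums at `u = 0` and `u = e₀` under `μL`). -/
def V1 (k : ℕ) : ℝ :=
  ∑ j ∈ Kwin k, (profile (rotCell₀ (3 * k) 1) j - profile (rotCell₀ (3 * k) 1) (j + k)) ^ 2

/-- Copy 1, reference rotated block (normalised), read on the coupled space. -/
def Fk (k : ℕ) (q : SpinConfig (Site 3) × SpinConfig (Site 3)) : ℝ :=
  normaliser μL (rotCell₀ (3 * k) 1) * blockSum (rotCell₀ (3 * k) 1) q.1

/-- Copy 1, rotated block `e₀` (normalised by the reference cell, as in the crux). -/
def Gk (k : ℕ) (q : SpinConfig (Site 3) × SpinConfig (Site 3)) : ℝ :=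
  normaliser μL (rotCell₀ (3 * k) 1) * blockSum (rotCell (3 * k) 1 (Pi.single 0 1)) q.1

/-- Copy 2, reference axis block (normalised). -/
def Hk (k : ℕ) (q : SpinConfig (Site 3) × SpinConfig (Site 3)) : ℝ :=
  normaliser μL (axisCell₀ (3 * k)) * blockSum (axisCell₀ (3 * k)) q.2

/-- Copy 2, axis block `e₀` (normalised). -/
def Kk (k : ℕ) (q : SpinConfig (Site 3) × SpinConfig (Site 3)) : ℝ :=
  normaliser μL (axisCell₀ (3 * k)) * blockSum (axisCell (3 * k) (Pi.single 0 1)) q.2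

end

end Summit.CriticalPhenomena.Ising3DConformalLimit.Theorems.RotationJoining.Negative
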